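import Mathlib
import HarnessLib

/-!
# Hoeffding's (Efron–Stein, ANOVA) decomposition on a finite product of a probability space — the averaging operators

W. Hoeffding, *A class of statistics with asymptotically normal distribution*, Ann. Math. Statist. 19 (1948), §5 (the
decomposition of a symmetric statistic of independent variables into mutually orthogonal parts indexed by subsets of the
variables), and B. Efron, C. Stein, *The jackknife estimate of variance*, Ann. Statist. 9 (1981) 586–596, §2 ("ANOVA
decomposition": for INDEPENDENT `X₁,…,Xₙ` and integrable `S(X₁,…,Xₙ)`, `S = Σ_{A ⊆ [n]} S_A` with `S_A` a function of
`(X_i)_{i∈A}` alone whose conditional expectation given any proper sub-family vanishes).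

This file is the measure-theoretic twin of the tree's FINITE, uniform-measure module
`Literature/Combinatorics/Additive/ProductSpaceOperators.lean` (`Literature.Combinatorics.Additive.ProductSpace.condAvg`, …,
same names, same normal forms), for the product `X = ι → β` of finitely many copies of ONE probability space `(β, μ)`
(the case the tree's consumers need: independent Haar-distributed link variables of a lattice gauge field), and for
BOUNDED MEASURABLE real functions (so that every integral exists and Fubini is free):
* `condAvg μ A f = E_A f` — integrate OUT the coordinates in `A` (`(E_A f)(x) = ∫ f(x off A, y on A) dμ^{⊗A}(y)`; the Bochner
  twin of Mathlib's `ℝ≥0∞`-valued `MeasureTheory.lmarginal`, written with the same `Function.updateFinset`);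
  `condAvg_empty`, `condAvg_singleton`, `condAvg_univ` (`= ∫ f`), `condAvg_union` (Fubini), `condAvg_condAvg` (`E_A E_B = E_{A∪B}`),
  commutation, idempotence, linearity, the bound `|E_A f| ≤ C`, measurability, `integral_condAvg` (`∫ E_A f = ∫ f`),
  `condAvg_ae_eq_zero` (`E_A` maps a.e.-null functions to a.e.-null functions);
* `DependsOff A f` — `f` does not depend on the coordinates in `A`; `dependsOff_condAvg`, `DependsOff.condAvg_eq`, pull-through.
The Efron–Stein PARTS `f^{=T}`, the decomposition `f = Σ_T f^{=T}`, annihilation/uniqueness and transport under coordinate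
symmetries are in the sibling file `HoeffdingDecompositionParts.lean`.  No instances, no notation; standard axioms.
WHAT THIS IS NOT: no `L²`/orthogonality statements (only the pointwise and a.e. calculus), no infinite products, no
non-identical factors.
-/

set_option autoImplicit false

noncomputable section

open MeasureTheory Finset Function

namespace Literature.Probability.Independence.Hoeffding

variable {ι : Type*} [DecidableEq ι] {β : Type*} [MeasurableSpace β]
variable (μ : Measure β)

/-! ## The averaging operators `E_A` -/

/-- **`E_A`** (Hoeffding / Efron–Stein): integrate out the coordinates in `A` against `μ^{⊗A}`,
`(E_A f)(x) = ∫ f(updateFinset x A y) dμ^{⊗A}(y)`; a function of `x` that no longer depends on `x|_A`.  For independent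
`μ`-distributed coordinates this is the conditional expectation given the coordinates OFF `A`.
[cite: EfronStein1981, §2 (ANOVA decomposition)] -/
def condAvg (A : Finset ι) (f : (ι → β) → ℝ) (x : ι → β) : ℝ :=
  ∫ y : ↥A → β, f (updateFinset x A y) ∂(Measure.pi fun _ : ↥A => μ)

/-- `f` **does not depend on the coordinates in `A`**. [cite: EfronStein1981, §2] -/
def DependsOff (A : Finset ι) (f : (ι → β) → ℝ) : Prop :=
  ∀ x y : ι → β, (∀ i, i ∉ A → x i = y i) → f x = f y

variable {μ}

omit [DecidableEq ι] [MeasurableSpace β] in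
/-- [cite: EfronStein1981, §2] -/
theorem DependsOff.mono {A B : Finset ι} {f : (ι → β) → ℝ} (h : DependsOff A f) (hBA : B ⊆ A) :
    DependsOff B f :=
  fun x y hxy => h x y fun i hi => hxy i fun hiB => hi (hBA hiB)

omit [DecidableEq ι] [MeasurableSpace β] in
/-- A constant depends on nothing. [cite: EfronStein1981, §2] -/
theorem dependsOff_const (A : Finset ι) (c : ℝ) : DependsOff A (fun _ : ι → β => c) :=
  fun _ _ _ => rfl

/-- `E_A f` does not depend on the `A`-coordinates. [cite: EfronStein1981, §2] -/
theorem dependsOff_condAvg (A : Finset ι) (f : (ι → β) → ℝ) : DependsOff A (condAvg μ A f) := by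
  intro x x' h
  unfold condAvg
  congr 1
  funext y
  congr 1
  funext i
  by_cases hi : i ∈ A
  · simp [updateFinset, hi]
  · simp [updateFinset, hi, h i hi]

/-- More generally `E_A f` does not depend on `B` whenever `f` does not depend on `B \ A`. [cite: EfronStein1981, §2] -/
theorem dependsOff_condAvg_of_sdiff {A B : Finset ι} {f : (ι → β) → ℝ} (h : DependsOff (B \ A) f) :
    DependsOff B (condAvg μ A f) := by
  intro x x' hxx'
  unfold condAvg
  congr 1
  funext y
  refine h _ _ fun i hi => ?_
  by_cases hiA : i ∈ A
  · simp [updateFinset, hiA]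
  · have hiB : i ∉ B := fun hiB => hi (Finset.mem_sdiff.2 ⟨hiB, hiA⟩)
    simp [updateFinset, hiA, hxx' i hiB]

/-- The marginal is independent of the variables in `A` (pointwise form). [cite: EfronStein1981, §2] -/
theorem condAvg_congr (A : Finset ι) (f : (ι → β) → ℝ) {x y : ι → β} (h : ∀ i, i ∉ A → x i = y i) :
    condAvg μ A f x = condAvg μ A f y :=
  dependsOff_condAvg A f x y h

/-- `E_∅ = id`. [cite: EfronStein1981, §2] -/
@[simp] theorem condAvg_empty (f : (ι → β) → ℝ) : condAvg μ ∅ f = f := by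
  funext x
  simp only [condAvg, Measure.pi_of_empty (fun _ : ↥(∅ : Finset ι) => μ), updateFinset_empty]
  rw [integral_dirac]

section Prob

variable [IsProbabilityMeasure μ]

/-- If `f` does not depend on `A` then `E_A f = f`. [cite: EfronStein1981, §2] -/
theorem DependsOff.condAvg_eq {A : Finset ι} {f : (ι → β) → ℝ} (h : DependsOff A f) : condAvg μ A f = f := by
  funext x
  unfold condAvg
  have : ∀ y : ↥A → β, f (updateFinset x A y) = f x := fun y =>
    h _ _ fun i hi => by simp [updateFinset, hi]
  simp_rw [this]
  simp

/-- `E_A c = c`. [cite: EfronStein1981, §2] -/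
@[simp] theorem condAvg_const (A : Finset ι) (c : ℝ) : condAvg μ A (fun _ : ι → β => c) = fun _ => c :=
  (dependsOff_const A c).condAvg_eq

end Prob

/-- `E_A` is linear: scalars. [cite: EfronStein1981, §2] -/
theorem condAvg_smul (A : Finset ι) (c : ℝ) (f : (ι → β) → ℝ) :
    condAvg μ A (fun x => c * f x) = fun x => c * condAvg μ A f x := by
  funext x
  simp only [condAvg, integral_const_mul]

/-- [cite: EfronStein1981, §2] -/
theorem condAvg_neg (A : Finset ι) (f : (ι → β) → ℝ) :
    condAvg μ A (fun x => -f x) = fun x => -condAvg μ A f x := by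
  funext x
  simp only [condAvg, integral_neg]

/-- **Uniform bound**: `|f| ≤ C` implies `|E_A f| ≤ C` (probability factors). [cite: EfronStein1981, §2] -/
theorem abs_condAvg_le [IsProbabilityMeasure μ] {A : Finset ι} {f : (ι → β) → ℝ} {C : ℝ} (hC : ∀ x, |f x| ≤ C) (x : ι → β) :
    |condAvg μ A f x| ≤ C := by
  unfold condAvg
  have h := norm_integral_le_of_norm_le_const (μ := Measure.pi fun _ : ↥A => μ)
    (f := fun y : ↥A → β => f (updateFinset x A y)) (C := C) (Filter.Eventually.of_forall fun y => hC _)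
  simpa using h

/-- `|E_A f| ≤ E_A |f|` pointwise. [cite: EfronStein1981, §2] -/
theorem abs_condAvg_le_condAvg_abs (A : Finset ι) (f : (ι → β) → ℝ) (x : ι → β) :
    |condAvg μ A f x| ≤ condAvg μ A (fun z => |f z|) x := by
  unfold condAvg
  exact abs_integral_le_integral_abs

/-- `E_A` is monotone. [cite: EfronStein1981, §2] -/
theorem condAvg_nonneg {A : Finset ι} {f : (ι → β) → ℝ} (hf : ∀ x, 0 ≤ f x) (x : ι → β) : 0 ≤ condAvg μ A f x :=
  integral_nonneg fun _ => hf _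

variable {f g : (ι → β) → ℝ}

/-- A bounded measurable section is integrable against the finite product measure. [cite: EfronStein1981, §2] -/
theorem integrable_updateFinset [IsProbabilityMeasure μ] (A : Finset ι) (hf : Measurable f) {C : ℝ} (hC : ∀ x, |f x| ≤ C) (x : ι → β) :
    Integrable (fun y : ↥A → β => f (updateFinset x A y)) (Measure.pi fun _ : ↥A => μ) := by
  refine Integrable.mono' (integrable_const C) ?_ (Filter.Eventually.of_forall fun y => ?_)
  · exact (hf.comp measurable_updateFinset).aestronglyMeasurable
  · rw [Real.norm_eq_abs]; exact hC _

/-- `E_A f` is measurable (for measurable `f`). [cite: EfronStein1981, §2] -/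
theorem measurable_condAvg [SigmaFinite μ] (A : Finset ι) (hf : Measurable f) : Measurable (condAvg μ A f) := by
  unfold condAvg
  have h : StronglyMeasurable (uncurry fun (x : ι → β) (y : ↥A → β) => f (updateFinset x A y)) :=
    (hf.comp measurable_updateFinset').stronglyMeasurable
  exact h.integral_prod_right.measurable

/-- `E_A` is linear: sums (bounded measurable summands). [cite: EfronStein1981, §2] -/
theorem condAvg_add [IsProbabilityMeasure μ] (A : Finset ι) (hf : Measurable f) {C : ℝ} (hC : ∀ x, |f x| ≤ C)
    (hg : Measurable g) {D : ℝ} (hD : ∀ x, |g x| ≤ D) :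
    condAvg μ A (fun x => f x + g x) = fun x => condAvg μ A f x + condAvg μ A g x := by
  funext x
  simp only [condAvg]
  exact integral_add (integrable_updateFinset A hf hC x) (integrable_updateFinset A hg hD x)

/-- `E_A` is linear: differences. [cite: EfronStein1981, §2] -/
theorem condAvg_sub [IsProbabilityMeasure μ] (A : Finset ι) (hf : Measurable f) {C : ℝ} (hC : ∀ x, |f x| ≤ C)
    (hg : Measurable g) {D : ℝ} (hD : ∀ x, |g x| ≤ D) :
    condAvg μ A (fun x => f x - g x) = fun x => condAvg μ A f x - condAvg μ A g x := by
  funext x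
  simp only [condAvg]
  exact integral_sub (integrable_updateFinset A hf hC x) (integrable_updateFinset A hg hD x)

/-- `E_A` of a finite sum of bounded measurable functions. [cite: EfronStein1981, §2] -/
theorem condAvg_finset_sum [IsProbabilityMeasure μ] {κ : Type*} (s : Finset κ) (A : Finset ι) (F : κ → (ι → β) → ℝ)
    (hF : ∀ k ∈ s, Measurable (F k)) (hB : ∀ k ∈ s, ∃ C : ℝ, ∀ x, |F k x| ≤ C) :
    condAvg μ A (fun x => ∑ k ∈ s, F k x) = fun x => ∑ k ∈ s, condAvg μ A (F k) x := by
  funext x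
  simp only [condAvg]
  rw [integral_finsetSum]
  intro k hk
  obtain ⟨C, hC⟩ := hB k hk
  exact integrable_updateFinset A (hF k hk) hC x

/-- **Pull-through**: a bounded measurable factor not depending on `A` comes out of `E_A`. [cite: EfronStein1981, §2] -/
theorem condAvg_mul_of_dependsOff {A : Finset ι} (hg : DependsOff A g) (f : (ι → β) → ℝ) :
    condAvg μ A (fun x => g x * f x) = fun x => g x * condAvg μ A f x := by
  funext x
  unfold condAvg
  have : ∀ y : ↥A → β, g (updateFinset x A y) = g x := fun y =>
    hg _ _ fun i hi => by simp [updateFinset, hi]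
  simp_rw [this]
  exact integral_const_mul _ _

/-- `E_{i}` is one integral. [cite: EfronStein1981, §2] -/
theorem condAvg_singleton [SigmaFinite μ] (i : ι) (f : (ι → β) → ℝ) :
    condAvg μ {i} f = fun x => ∫ b, f (Function.update x i b) ∂μ := by
  let α' : Type _ := (({i} : Finset ι) : Type _)
  let e := (MeasurableEquiv.piUnique fun _ : α' => β).symm
  funext x
  calc condAvg μ {i} f x
      = ∫ b : β, f (updateFinset x {i} (e b)) ∂μ := by
        simp only [condAvg]
        rw [← (measurePreserving_piUnique (fun _ : α' => μ)).symm _ |>.integral_comp']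
    _ = ∫ b, f (Function.update x i b) ∂μ := by
        congr 1
        funext b
        rw [update_eq_updateFinset]
        rfl

section Univ

variable [Fintype ι]

/-- `E_univ f` is the constant `∫ f dμ^{⊗ι}`. [cite: EfronStein1981, §2] -/
theorem condAvg_univ [SigmaFinite μ] (f : (ι → β) → ℝ) :
    condAvg μ univ f = fun _ => ∫ z, f z ∂(Measure.pi fun _ : ι => μ) := by
  funext x
  simp only [condAvg]
  rw [← (measurePreserving_piCongrLeft (fun _ : ι => μ) (Equiv.subtypeUnivEquiv mem_univ)).integral_comp']
  congr 1
  funext y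
  congr 1
  funext j
  obtain ⟨a, rfl⟩ := (Equiv.subtypeUnivEquiv (mem_univ (α := ι))).surjective j
  rw [MeasurableEquiv.piCongrLeft_apply_apply]
  simp [updateFinset]

end Univ

/-- **Fubini for the averaging operators**: `E_{A ∪ B} = E_A E_B` for disjoint `A`, `B` (bounded measurable `f`).
[cite: EfronStein1981, §2] -/
theorem condAvg_union [IsProbabilityMeasure μ] {A B : Finset ι} (hAB : Disjoint A B) (hf : Measurable f) {C : ℝ} (hC : ∀ x, |f x| ≤ C) :
    condAvg μ (A ∪ B) f = condAvg μ A (condAvg μ B f) := by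
  funext x
  let e := MeasurableEquiv.piFinsetUnion (fun _ : ι => β) hAB
  calc condAvg μ (A ∪ B) f x
      = ∫ y : ↥(A ∪ B) → β, f (updateFinset x (A ∪ B) y) ∂(Measure.pi fun _ : ↥(A ∪ B) => μ) := rfl
    _ = ∫ p : (↥A → β) × (↥B → β), f (updateFinset x (A ∪ B) (e p))
          ∂((Measure.pi fun _ : ↥A => μ).prod (Measure.pi fun _ : ↥B => μ)) :=
        ((measurePreserving_piFinsetUnion hAB (fun _ : ι => μ)).integral_comp'
          (fun y => f (updateFinset x (A ∪ B) y))).symm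
    _ = ∫ y : ↥A → β, ∫ z : ↥B → β, f (updateFinset x (A ∪ B) (e (y, z)))
          ∂(Measure.pi fun _ : ↥B => μ) ∂(Measure.pi fun _ : ↥A => μ) := by
        apply integral_prod
        refine Integrable.mono' (integrable_const C) ?_ (Filter.Eventually.of_forall fun p => ?_)
        · exact (hf.comp (measurable_updateFinset.comp e.measurable)).aestronglyMeasurable
        · rw [Real.norm_eq_abs]; exact hC _
    _ = condAvg μ A (condAvg μ B f) x := by
        simp only [condAvg]
        congr 1
        funext y
        congr 1
        funext z
        rw [updateFinset_updateFinset hAB]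
        rfl

/-- Coordinates a function does not depend on may be dropped from the averaging set. [cite: EfronStein1981, §2] -/
theorem condAvg_eq_condAvg_sdiff [IsProbabilityMeasure μ] {A B : Finset ι} (h : DependsOff B f) (hf : Measurable f) {C : ℝ}
    (hC : ∀ x, |f x| ≤ C) : condAvg μ A f = condAvg μ (A \ B) f := by
  have hsplit : A = (A \ B) ∪ (A ∩ B) := (Finset.sdiff_union_inter A B).symm
  conv_lhs => rw [hsplit]
  rw [condAvg_union (Finset.disjoint_sdiff_inter A B) hf hC, (h.mono Finset.inter_subset_right).condAvg_eq]

/-- **`E_A E_B = E_{A ∪ B}`** (bounded measurable `f`); in particular the `E_A` commute and are idempotent.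
[cite: EfronStein1981, §2] -/
theorem condAvg_condAvg [IsProbabilityMeasure μ] (A B : Finset ι) (hf : Measurable f) {C : ℝ} (hC : ∀ x, |f x| ≤ C) :
    condAvg μ A (condAvg μ B f) = condAvg μ (A ∪ B) f := by
  rw [condAvg_eq_condAvg_sdiff (dependsOff_condAvg B f) (measurable_condAvg B hf) (fun x => abs_condAvg_le hC x),
    ← condAvg_union Finset.sdiff_disjoint hf hC, Finset.sdiff_union_self_eq_union]

/-- [cite: EfronStein1981, §2] -/
theorem condAvg_comm [IsProbabilityMeasure μ] (A B : Finset ι) (hf : Measurable f) {C : ℝ} (hC : ∀ x, |f x| ≤ C) :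
    condAvg μ A (condAvg μ B f) = condAvg μ B (condAvg μ A f) := by
  rw [condAvg_condAvg A B hf hC, condAvg_condAvg B A hf hC, Finset.union_comm]

/-- [cite: EfronStein1981, §2] -/
theorem condAvg_idem [IsProbabilityMeasure μ] (A : Finset ι) (hf : Measurable f) {C : ℝ} (hC : ∀ x, |f x| ≤ C) :
    condAvg μ A (condAvg μ A f) = condAvg μ A f := by
  rw [condAvg_condAvg A A hf hC, Finset.union_idempotent]

section Univ2

variable [Fintype ι]

/-- **The total integral is `E_A`-invariant**: `∫ E_A f = ∫ f`. [cite: EfronStein1981, §2] -/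
theorem integral_condAvg [IsProbabilityMeasure μ] (A : Finset ι) (hf : Measurable f) {C : ℝ} (hC : ∀ x, |f x| ≤ C) :
    ∫ x, condAvg μ A f x ∂(Measure.pi fun _ : ι => μ) = ∫ x, f x ∂(Measure.pi fun _ : ι => μ) := by
  haveI : Nonempty β := nonempty_of_isProbabilityMeasure μ
  obtain ⟨x₀⟩ : Nonempty (ι → β) := inferInstance
  have h1 := congrFun (condAvg_univ (μ := μ) (condAvg μ A f)) x₀
  have h2 := congrFun (condAvg_univ (μ := μ) f) x₀
  rw [← h1, ← h2, condAvg_condAvg _ _ hf hC, show (univ : Finset ι) ∪ A = univ from Finset.eq_univ_of_forall fun i => by simp]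

/-- **`E_A` preserves a.e.-nullity**: a bounded measurable `f` vanishing `μ^{⊗ι}`-a.e. has `E_A f = 0` a.e. [cite: EfronStein1981, §2] -/
theorem condAvg_ae_eq_zero [IsProbabilityMeasure μ] (A : Finset ι) (hf : Measurable f) {C : ℝ} (hC : ∀ x, |f x| ≤ C)
    (h0 : f =ᵐ[Measure.pi fun _ : ι => μ] 0) :
    condAvg μ A f =ᵐ[Measure.pi fun _ : ι => μ] 0 := by
  have habs : Measurable fun x => |f x| := hf.abs
  have hCabs : ∀ x, |(fun x => |f x|) x| ≤ C := fun x => by simpa using hC x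
  -- `∫ E_A |f| = ∫ |f| = 0`
  have hint : ∫ x, condAvg μ A (fun z => |f z|) x ∂(Measure.pi fun _ : ι => μ) = 0 := by
    rw [integral_condAvg A habs hCabs]
    have : (fun x => |f x|) =ᵐ[Measure.pi fun _ : ι => μ] 0 := by
      filter_upwards [h0] with x hx
      simp [hx]
    rw [integral_congr_ae this]
    simp
  have hnn : 0 ≤ᵐ[Measure.pi fun _ : ι => μ] condAvg μ A (fun z => |f z|) :=
    Filter.Eventually.of_forall fun x => condAvg_nonneg (fun z => abs_nonneg _) x
  have hmeas : Integrable (condAvg μ A fun z => |f z|) (Measure.pi fun _ : ι => μ) :=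
    Integrable.mono' (integrable_const C) (measurable_condAvg A habs).aestronglyMeasurable
      (Filter.Eventually.of_forall fun x => by
        rw [Real.norm_eq_abs]; exact abs_condAvg_le hCabs x)
  have hz := (integral_eq_zero_iff_of_nonneg_ae hnn hmeas).1 hint
  filter_upwards [hz] with x hx
  have := abs_condAvg_le_condAvg_abs (μ := μ) A f x
  rw [hx] at this
  exact abs_nonpos_iff.1 this

end Univ2

end Literature.Probability.Independence.Hoeffding
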